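import Mathlib
import HarnessLib
import Summits.NavierStokesRegularity.NavierStokesRegularity.Theses.RootDecompLerayBranching
import Summits.NavierStokesRegularity.NavierStokesRegularity.Theorems.RootDecompMarginalRateMarginalReduction
import Literature.Analysis.FluidPDE.NSKatoToClayHolds
import Literature.Claims.NS.ClayVariants

/-!
# `BreakdownHasMaximalSolution` — Kato's dichotomy in Clay clothes (K) on route `RootDecompLerayBranching` (N3)

Item stmt-NavierStokesRegularity-25536, kind support («PROVABLE NOW», critic row 4): if the Clay problem
(A) fails at `(ν, u₀)` for a Clay datum `u₀` (smooth, divergence free, rapidly decaying), then the Cauchy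
problem has a maximal smooth solution with finite lifespan `T > 0`, equal to `u₀` at time `0` and
Leray–Hopf on `[0, T]`.

Proof (bookkeeping over the tree): a global Kato solution from a Clay datum IS a Clay solution
(`clay_solution_of_hasGlobalKatoSolution_holds`, Lemarié-Rieusset 2016 Prop. 12.3 / Thm. 7.2 / 7.7), so
`¬ clayR3.Solvable ν 0 u₀` forces `¬ HasGlobalKatoSolution ν u₀`; then the landed helper
`Theorems.MarginalReduction.exists_isMaximalSmoothSolution_of_not_hasGlobalKatoSolution` (p793251: Kato's
maximal mild solution is smooth, Leray–Hopf on its lifespan, and blows up at a finite `T`) gives the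
maximal smooth solution.  No new definitions.  Sources: Kato1984; Leray1934; LemarieRieusset2016.
-/

set_option linter.dupNamespace false

noncomputable section

open Literature.Analysis Literature.Analysis.FluidPDE MeasureTheory Filter Topology

namespace Summit.NavierStokesRegularity.NavierStokesRegularity.Theorems.BreakdownHasMaximalSolution

/-- For a Clay datum, failure of Clay solvability at viscosity `ν` forces failure of Kato globality. -/
theorem not_hasGlobalKatoSolution_of_not_solvable {ν : ℝ} (hν : 0 < ν)
    {u₀ : EuclideanSpace ℝ (Fin 3) → EuclideanSpace ℝ (Fin 3)} (hsm : ContDiff ℝ (⊤ : ℕ∞) u₀)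
    (hdiv : NSWave0.IsDivFree u₀) (hdec : HasRapidSpatialDecay u₀)
    (hnot : ¬ Literature.Claims.NS.ClayVariants.clayR3.Solvable ν 0 u₀) :
    ¬ HasGlobalKatoSolution ν u₀ := by
  intro hK
  obtain ⟨u, p, hu, hp, hns, hE⟩ :=
    clay_solution_of_hasGlobalKatoSolution_holds ν hν u₀ hsm hdiv hdec hK
  exact hnot ⟨u, p, hu, hp, hns, hE⟩

/-- **K, the route decl** `RootDecompLerayBranching.BreakdownHasMaximalSolution` (item
stmt-NavierStokesRegularity-25536). -/
theorem breakdownHasMaximalSolution_proof :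
    Theses.RootDecompLerayBranching.BreakdownHasMaximalSolution := by
  intro ν hν u₀ hsm hdiv hdec hnot
  have hK : ¬ HasGlobalKatoSolution ν u₀ :=
    not_hasGlobalKatoSolution_of_not_solvable hν hsm hdiv hdec hnot
  obtain ⟨T, hT, V, P, hmax, hLH, hV0⟩ :=
    MarginalReduction.exists_isMaximalSmoothSolution_of_not_hasGlobalKatoSolution hν hsm hdiv hdec hK
  exact ⟨T, hT, V, P, hmax, hV0, hLH⟩

end Summit.NavierStokesRegularity.NavierStokesRegularity.Theorems.BreakdownHasMaximalSolution

end
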